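import Summits.AtomisticToContinuum.FouriersLaw.Theorems.OddSectorIrreversibilityResponseDensityBackwardPDE

/-!
# Gradients of the forecasts of the pinned chain: formulas, joint continuity, the energy functional

Helper file for item stmt-AtomisticToContinuum-9144 (`ResponseDensity`, route
`OddSectorIrreversibility`, sub-problem `FouriersLaw` of `AtomisticToContinuum`), fourth step towards
the detailed balance of the equilibrium kernels. For `F ∈ C_c^∞` and the smooth forecast
`u(s, x) = P_s F(x)` (`s > 0`):

* `pinnedChain_hasFDerivAt_forecast_slice`, `pinnedChain_fderiv_forecast_apply` — the `x`-derivative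
  of the slice `u(s, ·)` is the partial derivative of the jointly smooth `u`;
* `pinnedChain_continuousOn_fderiv_forecast`, `pinnedChain_continuousOn_carreDuChamp_forecast` —
  `(s, x) ↦ Du(s,·)(x)·v` and the carré du champ `Γ(u_s)(x)` are continuous on `(0,∞) × Ω`;
* `pinnedChain_hasDerivAt_integral_weight_forecast_sq` — for a continuous compactly supported
  weight `ρ`, `d/ds ∫ ρ u_s² dx = ∫ ρ · 2 u_s P_s(LF) dx` (`s > 0`);
* `continuousOn_integral_of_continuousOn_prod`, `pinnedChain_abs_forecast_le` — two elementary tools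
  (continuity of parametric integrals with uniformly compact support; `|P_t F| ≤ sup |F|`).

No definitions.
-/

noncomputable section

open MeasureTheory ProbabilityTheory Filter Topology Set Function Metric
open scoped NNReal ENNReal ContDiff

namespace Summit.AtomisticToContinuum.FouriersLaw.Theorems

open Literature.MathematicalPhysics.KineticTheory.HeatConduction
open Literature.Probability.Process Literature.MathematicalPhysics.KineticTheory OscillatorChain

variable {N : ℕ}

/-- **Continuity of parametric integrals** of an integrand jointly continuous on `(0,∞) × Ω` and
supported in a fixed compact set in the space variable. -/
theorem continuousOn_integral_of_continuousOn_prod {Φ : ℝ × PhaseSpace N → ℝ}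
    (hΦ : ContinuousOn Φ (Set.Ioi (0 : ℝ) ×ˢ Set.univ)) {Kc : Set (PhaseSpace N)} (hKc : IsCompact Kc)
    (hsupp : ∀ s x, x ∉ Kc → Φ (s, x) = 0) :
    ContinuousOn (fun s : ℝ => ∫ x, Φ (s, x)) (Set.Ioi 0) := by
  intro s₀ hs₀
  simp only [Set.mem_Ioi] at hs₀
  refine ContinuousAt.continuousWithinAt ?_
  have hJ : IsCompact (Set.Icc (s₀ / 2) (2 * s₀)) := isCompact_Icc
  have hJsub : Set.Icc (s₀ / 2) (2 * s₀) ×ˢ Kc ⊆ Set.Ioi (0 : ℝ) ×ˢ Set.univ := by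
    rintro ⟨s, x⟩ ⟨hs, -⟩
    exact ⟨lt_of_lt_of_le (by positivity) hs.1, Set.mem_univ _⟩
  obtain ⟨M, hM⟩ := (hJ.prod hKc).exists_bound_of_continuousOn (hΦ.mono hJsub)
  have hnhds : Set.Ioo (s₀ / 2) (2 * s₀) ∈ 𝓝 s₀ := Ioo_mem_nhds (by linarith) (by linarith)
  have hslice : ∀ s : ℝ, 0 < s → Continuous fun x => Φ (s, x) := fun s hs =>
    hΦ.comp_continuous (by fun_prop) fun x => ⟨hs, Set.mem_univ _⟩
  refine continuousAt_of_dominated (bound := Kc.indicator fun _ => M) ?_ ?_ ?_ ?_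
  · filter_upwards [hnhds] with s hs
    exact (hslice s (lt_of_lt_of_le (by positivity) hs.1.le)).aestronglyMeasurable
  · filter_upwards [hnhds] with s hs
    refine Eventually.of_forall fun x => ?_
    by_cases hx : x ∈ Kc
    · rw [Set.indicator_of_mem hx]
      exact hM (s, x) ⟨⟨hs.1.le, hs.2.le⟩, hx⟩
    · rw [Set.indicator_of_notMem hx, hsupp s x hx, norm_zero]
  · exact (integrableOn_const (hKc.measure_lt_top.ne)).integrable_indicator hKc.measurableSet
  · refine Eventually.of_forall fun x => ?_
    have h1 : ContinuousAt Φ (s₀, x) :=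
      (hΦ (s₀, x) ⟨hs₀, Set.mem_univ _⟩).continuousAt
        ((isOpen_Ioi.prod isOpen_univ).mem_nhds ⟨hs₀, Set.mem_univ _⟩)
    exact h1.comp (f := fun s : ℝ => (s, x)) (by fun_prop : Continuous fun s : ℝ => (s, x)).continuousAt

/-- `|P_t F(z)| ≤ C_F` when `|F| ≤ C_F`. -/
theorem pinnedChain_abs_forecast_le {ω₂ lam β γ : ℝ} (hω : 0 < ω₂) (hl : 0 ≤ lam) (hβ : 0 ≤ β) (hγ : 0 ≤ γ)
    (N : ℕ) (T_L T_R : ℝ) {F : PhaseSpace N → ℝ} {CF : ℝ} (hCF : ∀ y, |F y| ≤ CF) (t : ℝ≥0) (z : PhaseSpace N) :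
    |∫ y, F y ∂((pinnedChain ω₂ lam β γ).transitionKernel N T_L T_R t z)| ≤ CF := by
  haveI := pinnedChain_isMarkovKernel_transitionKernel hω hl hβ hγ N T_L T_R t
  rw [← Real.norm_eq_abs]
  calc _ ≤ ∫ y, ‖F y‖ ∂((pinnedChain ω₂ lam β γ).transitionKernel N T_L T_R t z) :=
        norm_integral_le_integral_norm _
    _ ≤ ∫ y, CF ∂((pinnedChain ω₂ lam β γ).transitionKernel N T_L T_R t z) :=
        integral_mono_of_nonneg (Eventually.of_forall fun _ => norm_nonneg _) (integrable_const _)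
          (Eventually.of_forall fun y => (Real.norm_eq_abs _).le.trans (hCF y))
    _ = CF := by simp

section Gradient

variable {ω₂ lam β γ : ℝ} (hω : 0 < ω₂) (hl : 0 ≤ lam) (hβ : 0 ≤ β) (hγ : 0 < γ) (hN : 0 < N)
  {T_L T_R : ℝ} (hL : 0 < T_L) (hR : 0 ≤ T_R)
  {F : PhaseSpace N → ℝ} (hF : ContDiff ℝ ∞ F) (hFc : HasCompactSupport F)
include hω hl hβ hγ hN hL hR hF hFc

/-- The slice `u(s, ·)` of the forecast is differentiable with derivative the partial derivative of
the jointly smooth `u` (`s > 0`). -/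
theorem pinnedChain_hasFDerivAt_forecast_slice {s : ℝ} (hs : 0 < s) (x : PhaseSpace N) :
    HasFDerivAt (fun z => ∫ y, F y ∂((pinnedChain ω₂ lam β γ).transitionKernel N T_L T_R s.toNNReal z))
      ((fderiv ℝ (fun w : ℝ × PhaseSpace N =>
          ∫ y, F y ∂((pinnedChain ω₂ lam β γ).transitionKernel N T_L T_R w.1.toNNReal w.2)) (s, x)).comp
        (ContinuousLinearMap.inr ℝ ℝ (PhaseSpace N))) x := by
  have hU := pinnedChain_contDiffOn_forecast hω hl hβ hγ hN hL hR hF.continuous hFc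
  have hdiff : DifferentiableAt ℝ (fun w : ℝ × PhaseSpace N =>
      ∫ y, F y ∂((pinnedChain ω₂ lam β γ).transitionKernel N T_L T_R w.1.toNNReal w.2)) (s, x) :=
    (hU.differentiableOn (by simp)).differentiableAt
      ((isOpen_Ioi.prod isOpen_univ).mem_nhds ⟨hs, Set.mem_univ _⟩)
  exact hdiff.hasFDerivAt.comp x (hasFDerivAt_prodMk_right s x)

/-- `Du(s,·)(x)·v = Du(s, x)·(0, v)`. -/
theorem pinnedChain_fderiv_forecast_apply {s : ℝ} (hs : 0 < s) (x v : PhaseSpace N) :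
    fderiv ℝ (fun z => ∫ y, F y ∂((pinnedChain ω₂ lam β γ).transitionKernel N T_L T_R s.toNNReal z)) x v =
      fderiv ℝ (fun w : ℝ × PhaseSpace N =>
        ∫ y, F y ∂((pinnedChain ω₂ lam β γ).transitionKernel N T_L T_R w.1.toNNReal w.2)) (s, x) (0, v) := by
  rw [(pinnedChain_hasFDerivAt_forecast_slice hω hl hβ hγ hN hL hR hF hFc hs x).fderiv]
  simp

/-- `(s, x) ↦ Du(s,·)(x)·v` is continuous on `(0,∞) × Ω`. -/
theorem pinnedChain_continuousOn_fderiv_forecast (v : PhaseSpace N) :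
    ContinuousOn (fun w : ℝ × PhaseSpace N =>
      fderiv ℝ (fun z => ∫ y, F y ∂((pinnedChain ω₂ lam β γ).transitionKernel N T_L T_R w.1.toNNReal z))
        w.2 v) (Set.Ioi (0 : ℝ) ×ˢ Set.univ) := by
  have hU := pinnedChain_contDiffOn_forecast hω hl hβ hγ hN hL hR hF.continuous hFc
  have hc := (hU.continuousOn_fderiv_of_isOpen (isOpen_Ioi.prod isOpen_univ) (by simp)).clm_apply
    (continuousOn_const (c := ((0 : ℝ), v)))
  refine hc.congr fun w hw => ?_
  exact pinnedChain_fderiv_forecast_apply hω hl hβ hγ hN hL hR hF hFc hw.1 w.2 v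

/-- The carré du champ of the forecast, `(s, x) ↦ Γ(u_s)(x)`, is continuous on `(0,∞) × Ω`. -/
theorem pinnedChain_continuousOn_carreDuChamp_forecast (v₁ v₂ : PhaseSpace N) :
    ContinuousOn (fun w : ℝ × PhaseSpace N =>
      carreDuChamp v₁ v₂
        (fun z => ∫ y, F y ∂((pinnedChain ω₂ lam β γ).transitionKernel N T_L T_R w.1.toNNReal z))
        (fun z => ∫ y, F y ∂((pinnedChain ω₂ lam β γ).transitionKernel N T_L T_R w.1.toNNReal z)) w.2)
      (Set.Ioi (0 : ℝ) ×ˢ Set.univ) := by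
  simp only [carreDuChamp_def]
  exact ((pinnedChain_continuousOn_fderiv_forecast hω hl hβ hγ hN hL hR hF hFc v₁).mul
    (pinnedChain_continuousOn_fderiv_forecast hω hl hβ hγ hN hL hR hF hFc v₁)).add
    ((pinnedChain_continuousOn_fderiv_forecast hω hl hβ hγ hN hL hR hF hFc v₂).mul
      (pinnedChain_continuousOn_fderiv_forecast hω hl hβ hγ hN hL hR hF hFc v₂))

/-- **The energy functional**: for a continuous compactly supported weight `ρ` and `s > 0`,
`d/ds ∫ ρ u_s² dx = ∫ ρ · 2 u_s · P_s(LF) dx`. -/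
theorem pinnedChain_hasDerivAt_integral_weight_forecast_sq {ρ : PhaseSpace N → ℝ} (hρ : Continuous ρ)
    (hρc : HasCompactSupport ρ) {s : ℝ} (hs : 0 < s) :
    HasDerivAt (fun r : ℝ => ∫ x, ρ x *
        (∫ y, F y ∂((pinnedChain ω₂ lam β γ).transitionKernel N T_L T_R r.toNNReal x)) ^ 2)
      (∫ x, ρ x * (2 * (∫ y, F y ∂((pinnedChain ω₂ lam β γ).transitionKernel N T_L T_R s.toNNReal x)) *
        ∫ y, (pinnedChain ω₂ lam β γ).generator N T_L T_R F y
          ∂((pinnedChain ω₂ lam β γ).transitionKernel N T_L T_R s.toNNReal x))) s := by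
  have hF2 : ContDiff ℝ 2 F := hF.of_le (by norm_cast)
  obtain ⟨CF, hCF⟩ : ∃ C, ∀ y, ‖F y‖ ≤ C := hF.continuous.bounded_above_of_compact_support hFc
  have hLc : Continuous ((pinnedChain ω₂ lam β γ).generator N T_L T_R F) :=
    (pinnedChain ω₂ lam β γ).continuous_generator (pinnedChain_contDiff_U ω₂ lam β γ)
      (pinnedChain_contDiff_V ω₂ lam β γ) N T_L T_R hF2
  obtain ⟨CL, hCL⟩ := (pinnedChain ω₂ lam β γ).exists_bound_generator (pinnedChain_contDiff_U ω₂ lam β γ)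
    (pinnedChain_contDiff_V ω₂ lam β γ) N T_L T_R hF2 hFc
  -- names
  obtain ⟨u, hu⟩ : ∃ u : ℝ → PhaseSpace N → ℝ, u = fun r z =>
      ∫ y, F y ∂((pinnedChain ω₂ lam β γ).transitionKernel N T_L T_R r.toNNReal z) := ⟨_, rfl⟩
  obtain ⟨g, hg⟩ : ∃ g : ℝ → PhaseSpace N → ℝ, g = fun r z =>
      ∫ y, (pinnedChain ω₂ lam β γ).generator N T_L T_R F y
        ∂((pinnedChain ω₂ lam β γ).transitionKernel N T_L T_R r.toNNReal z) := ⟨_, rfl⟩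
  have hux : ∀ r z, u r z = ∫ y, F y ∂((pinnedChain ω₂ lam β γ).transitionKernel N T_L T_R r.toNNReal z) :=
    fun r z => by rw [hu]
  have hgx : ∀ r z, g r z = ∫ y, (pinnedChain ω₂ lam β γ).generator N T_L T_R F y
      ∂((pinnedChain ω₂ lam β γ).transitionKernel N T_L T_R r.toNNReal z) := fun r z => by rw [hg]
  have hgoal : HasDerivAt (fun r : ℝ => ∫ x, ρ x * u r x ^ 2) (∫ x, ρ x * (2 * u s x * g s x)) s := by
    have hucont : ∀ r, Continuous (u r) := fun r => by
      rw [hu]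
      exact pinnedChain_continuous_integral_transitionKernel hω hl hβ hγ.le N T_L T_R _ hF.continuous hCF
    have hgc : ∀ r, Continuous (g r) := fun r => by
      rw [hg]
      exact pinnedChain_continuous_integral_transitionKernel hω hl hβ hγ.le N T_L T_R _ hLc hCL
    have hub : ∀ r z, ‖u r z‖ ≤ CF := by
      intro r z
      haveI := pinnedChain_isMarkovKernel_transitionKernel hω hl hβ hγ.le N T_L T_R r.toNNReal
      rw [hux]
      calc _ ≤ ∫ y, ‖F y‖ ∂((pinnedChain ω₂ lam β γ).transitionKernel N T_L T_R r.toNNReal z) :=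
            norm_integral_le_integral_norm _
        _ ≤ ∫ y, CF ∂((pinnedChain ω₂ lam β γ).transitionKernel N T_L T_R r.toNNReal z) :=
            integral_mono_of_nonneg (Eventually.of_forall fun _ => norm_nonneg _) (integrable_const _)
              (Eventually.of_forall fun y => hCF y)
        _ = CF := by simp
    have hgb : ∀ r z, ‖g r z‖ ≤ CL := by
      intro r z
      haveI := pinnedChain_isMarkovKernel_transitionKernel hω hl hβ hγ.le N T_L T_R r.toNNReal
      rw [hgx]
      calc _ ≤ ∫ y, ‖(pinnedChain ω₂ lam β γ).generator N T_L T_R F y‖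
            ∂((pinnedChain ω₂ lam β γ).transitionKernel N T_L T_R r.toNNReal z) := norm_integral_le_integral_norm _
        _ ≤ ∫ y, CL ∂((pinnedChain ω₂ lam β γ).transitionKernel N T_L T_R r.toNNReal z) :=
            integral_mono_of_nonneg (Eventually.of_forall fun _ => norm_nonneg _) (integrable_const _)
              (Eventually.of_forall fun y => hCL y)
        _ = CL := by simp
    have hCF0 : 0 ≤ CF := (norm_nonneg _).trans (hCF 0)
    have hCL0 : 0 ≤ CL := (norm_nonneg _).trans (hCL 0)
    have hmeas : ∀ r : ℝ, AEStronglyMeasurable (fun z => ρ z * u r z ^ 2) volume := fun r =>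
      (hρ.mul ((hucont r).pow 2)).aestronglyMeasurable
    have hmeas' : AEStronglyMeasurable (fun z => ρ z * (2 * u s z * g s z)) volume :=
      (hρ.mul ((continuous_const.mul (hucont s)).mul (hgc s))).aestronglyMeasurable
    have hint : Integrable (fun z => ρ z * u s z ^ 2) :=
      (hρ.mul ((hucont s).pow 2)).integrable_of_hasCompactSupport hρc.mul_right
    have hbound : ∀ᵐ z ∂(volume : Measure (PhaseSpace N)), ∀ r ∈ ball s (s / 2),
        ‖ρ z * (2 * u r z * g r z)‖ ≤ |ρ z| * (2 * CF * CL) := by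
      refine Eventually.of_forall fun z r _ => ?_
      rw [norm_mul, Real.norm_eq_abs]
      refine mul_le_mul_of_nonneg_left ?_ (abs_nonneg _)
      rw [norm_mul, norm_mul, Real.norm_eq_abs, abs_two]
      exact mul_le_mul (mul_le_mul_of_nonneg_left (hub r z) zero_le_two) (hgb r z) (norm_nonneg _)
        (by positivity)
    have hbint : Integrable (fun z => |ρ z| * (2 * CF * CL)) :=
      (hρ.abs.mul continuous_const).integrable_of_hasCompactSupport (hρc.norm.mul_right)
    have hdiff : ∀ᵐ z ∂(volume : Measure (PhaseSpace N)), ∀ r ∈ ball s (s / 2),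
        HasDerivAt (fun r => ρ z * u r z ^ 2) (ρ z * (2 * u r z * g r z)) r := by
      refine Eventually.of_forall fun z r hr => ?_
      have hr0 : 0 < r := by
        rw [mem_ball, Real.dist_eq] at hr
        have := abs_lt.1 hr
        linarith
      have hd : HasDerivAt (fun r => u r z) (g r z) r := by
        have h := pinnedChain_hasDerivAt_forecast_dynkin hω hl hβ hγ hN hL hR hF hFc hr0 z
        rw [← hgx] at h
        exact h.congr_of_eventuallyEq (Eventually.of_forall fun r' => hux r' z)
      have h2 := (hd.pow 2).const_mul (ρ z)
      refine h2.congr_deriv ?_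
      simp only [Nat.cast_ofNat, Nat.add_one_sub_one, pow_one]
    exact (hasDerivAt_integral_of_dominated_loc_of_deriv_le (ball_mem_nhds s (by positivity))
      (Eventually.of_forall hmeas) hint hmeas' hbound hbint hdiff).2
  rw [hu, hg] at hgoal
  exact hgoal

end Gradient

end Summit.AtomisticToContinuum.FouriersLaw.Theorems

end
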